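import Mathlib

/-!
# Crux `FeketeSOS.CharPSparseSOS` (stmt-ValiantsHypothesis-14989), line `Sketch-ideator5` — stub `stub_charSum211`

The `{u,u,v,w}` four-point character sum.  For an odd prime `p`, `χ_p = legendreSym p` and pairwise
distinct `u, v, w < p`:

`Σ_{x<p} χ_p((x+u)(x+u)(x+v)(x+w)) = −1 − χ_p((v−u)(w−u))`.

Proof.  Work in `ZMod p`, where `legendreSym p a = quadraticChar (ZMod p) a` by definition.  Off
`x ≡ −u` the factor `χ_p((x+u)²) = 1` drops; at `x ≡ −u` the term vanishes, while the two-point term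
`χ_p((x+v)(x+w))` there equals `χ_p((v−u)(w−u))`.  The remaining two-point sum is Jacobsthal's
`Σ_x χ_p((x+v)(x+w)) = −1` for `v ≢ w` (shift to `Σ_t χ(t(t+c))`, `c ≠ 0`, substitute `t ↦ 1 + c/t`
and use `Σ_z χ(z) = 0`).
-/

-- `Summit.ValiantsHypothesis.ValiantsHypothesis.…` is the tree's mandated single-conjunct layout (Sub = Summit).
set_option linter.dupNamespace false

namespace Summit.ValiantsHypothesis.ValiantsHypothesis.Theorems.CharPSparseSOSTraceBias

open Finset

/-- Jacobsthal: `Σ_t χ(t(t + c)) = −1` for `c ≠ 0` in `ZMod p`, `p` an odd prime (substitute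
`t ↦ 1 + c/t`). -/
theorem cs_sum_quadraticChar_mul_add (p : ℕ) [Fact p.Prime] (hp : p ≠ 2) {c : ZMod p}
    (hc : c ≠ 0) : ∑ t, quadraticChar (ZMod p) (t * (t + c)) = -1 := by
  -- adapted from Literature/Combinatorics/SimpleGraph/PaleySosProofs.lean
  -- (`sum_quadraticChar_mul_add_eq_neg_one`, there stated for moduli `≡ 1 (mod 4)`).
  have hF : ringChar (ZMod p) ≠ 2 := by rw [ZMod.ringChar_zmod_n]; exact hp
  let e : ZMod p ≃ ZMod p :=
    { toFun := fun x => 1 + c * x⁻¹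
      invFun := fun t => c * (t - 1)⁻¹
      left_inv := fun x => by
        simp only [add_sub_cancel_left, mul_inv, inv_inv, ← mul_assoc, mul_inv_cancel₀ hc, one_mul]
      right_inv := fun t => by
        simp only [mul_inv, inv_inv, ← mul_assoc, mul_inv_cancel₀ hc, one_mul, add_sub_cancel] }
  have key : ∀ x : ZMod p,
      quadraticChar (ZMod p) (x * (x + c)) =
        quadraticChar (ZMod p) (e x) - if x = 0 then 1 else 0 := by
    intro x
    by_cases hx : x = 0
    · simp [hx, e]
    · rw [if_neg hx, sub_zero, show x * (x + c) = x ^ 2 * (1 + c * x⁻¹) by field_simp]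
      rw [map_mul, map_pow, quadraticChar_sq_one hx, one_mul]
      rfl
  rw [Finset.sum_congr rfl (fun x _ => key x), Finset.sum_sub_distrib,
    Equiv.sum_comp e (fun x => quadraticChar (ZMod p) x), quadraticChar_sum_zero hF,
    Finset.sum_ite_eq' Finset.univ (0 : ZMod p) (fun _ => (1 : ℤ))]
  simp

/-- The shifted Jacobsthal sum: `Σ_y χ((y + V)(y + W)) = −1` for `V ≠ W` in `ZMod p`. -/
theorem cs_sum_quadraticChar_add_mul_add (p : ℕ) [Fact p.Prime] (hp : p ≠ 2) {V W : ZMod p}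
    (hVW : V ≠ W) : ∑ y, quadraticChar (ZMod p) ((y + V) * (y + W)) = -1 := by
  have hc : W - V ≠ 0 := sub_ne_zero.2 (Ne.symm hVW)
  have h := cs_sum_quadraticChar_mul_add p hp hc
  rw [← Equiv.sum_comp (Equiv.addRight V)
    (fun t => quadraticChar (ZMod p) (t * (t + (W - V))))] at h
  rw [← h]
  refine Finset.sum_congr rfl fun x _ => ?_
  simp only [Equiv.coe_addRight]
  congr 1
  ring

/-- The `{U,U,V,W}` sum in `ZMod p`: `Σ_y χ((y+U)(y+U)(y+V)(y+W)) = −1 − χ((V−U)(W−U))` for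
`V ≠ W`. -/
theorem cs_sum_quadraticChar_sq_mul (p : ℕ) [Fact p.Prime] (hp : p ≠ 2) {U V W : ZMod p}
    (hVW : V ≠ W) :
    ∑ y, quadraticChar (ZMod p) ((y + U) * (y + U) * (y + V) * (y + W)) =
      -1 - quadraticChar (ZMod p) ((V - U) * (W - U)) := by
  have key : ∀ y : ZMod p,
      quadraticChar (ZMod p) ((y + U) * (y + U) * (y + V) * (y + W)) =
        quadraticChar (ZMod p) ((y + V) * (y + W)) -
          if y = -U then quadraticChar (ZMod p) ((V - U) * (W - U)) else 0 := by
    intro y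
    by_cases hy : y = -U
    · rw [if_pos hy, hy, show (-U + V) * (-U + W) = (V - U) * (W - U) by ring, sub_self,
        neg_add_cancel, zero_mul, zero_mul, zero_mul, MulChar.map_zero]
    · have hne : y + U ≠ 0 := fun h => hy (eq_neg_of_add_eq_zero_left h)
      rw [if_neg hy, sub_zero,
        show (y + U) * (y + U) * (y + V) * (y + W) = (y + U) ^ 2 * ((y + V) * (y + W)) by ring,
        map_mul, quadraticChar_sq_one' hne, one_mul]
  rw [Finset.sum_congr rfl (fun y _ => key y), Finset.sum_sub_distrib,
    cs_sum_quadraticChar_add_mul_add p hp hVW,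
    Finset.sum_ite_eq' Finset.univ (-U) (fun _ => quadraticChar (ZMod p) ((V - U) * (W - U)))]
  simp

/-- Transport of a `legendreSym` sum over `range p` to a `quadraticChar` sum over `ZMod p`. -/
theorem cs_sum_range_legendreSym_eq (p : ℕ) [Fact p.Prime] (f : ℤ → ℤ) (g : ZMod p → ZMod p)
    (hfg : ∀ n : ℕ, ((f n : ℤ) : ZMod p) = g (n : ZMod p)) :
    ∑ x ∈ range p, legendreSym p (f x) = ∑ y : ZMod p, quadraticChar (ZMod p) (g y) := by
  refine Finset.sum_nbij' (fun n : ℕ => (n : ZMod p)) (fun y : ZMod p => y.val) (fun _ _ => mem_univ _)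
    (fun y _ => mem_range.2 (ZMod.val_lt y)) (fun n hn => ZMod.val_cast_of_lt (mem_range.1 hn))
    (fun y _ => ZMod.natCast_zmod_val y) (fun n _ => ?_)
  rw [legendreSym, hfg]

/-- **Stub 4 (the `{u,u,v,w}` character sum, elementary).**  For an odd prime `p` and pairwise distinct
`u, v, w < p`: `Σ_{x<p} χ_p((x+u)(x+u)(x+v)(x+w)) = −1 − χ_p((v−u)(w−u))` — drop the factor `χ_p((x+u)²) = 1`
off `x ≡ −u`, and use the Jacobsthal-type evaluation `Σ_x χ_p((x+v)(x+w)) = −1` for `v ≢ w`. -/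
theorem stub_charSum211 :
    ∀ (p : ℕ) [Fact p.Prime], p ≠ 2 → ∀ u v w : ℕ, u < p → v < p → w < p → u ≠ v → u ≠ w → v ≠ w →
      (∑ x ∈ range p, legendreSym p (((x : ℤ) + u) * ((x : ℤ) + u) * ((x : ℤ) + v) * ((x : ℤ) + w))) =
        -1 - legendreSym p (((v : ℤ) - u) * ((w : ℤ) - u)) := by
  intro p _ hp u v w _hu hv hw _huv _huw hvw
  have hVW : (v : ZMod p) ≠ (w : ZMod p) := by
    intro h
    apply hvw
    have h' := congrArg ZMod.val h
    rwa [ZMod.val_cast_of_lt hv, ZMod.val_cast_of_lt hw] at h'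
  rw [cs_sum_range_legendreSym_eq p
      (fun x => (x + u) * (x + u) * (x + v) * (x + w))
      (fun y => (y + u) * (y + u) * (y + v) * (y + w)) (fun n => by push_cast; ring),
    cs_sum_quadraticChar_sq_mul p hp hVW, legendreSym]
  push_cast
  ring

end Summit.ValiantsHypothesis.ValiantsHypothesis.Theorems.CharPSparseSOSTraceBias
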